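import Summits.QuantumFields.BalabanUV.Beta.MultiscaleCombesThomasL2

/-!
# `Summit.QuantumFields.BalabanUV.Beta.MultiscaleCombesThomasL2Real` — the ℓ²-LOCALIZED OPERATOR form of the site-local
# Combes–Thomas engine in the REAL-operator currency of the MODEL instance: for `A : Module.End ℝ (Y → ℝ)` with the
# conjugated-PAIRING hypothesis, `√(Σ_{p∈S}(A⁻¹u)_p²) ≤ e^{−κ(R−ω)}/√(νν′)·√(Σ_{p∈S′}u_p²)` (file 6 of the engine; the
# (3.46)₁ SHAPE fed by `MultiscaleDecay.hc_levelOp` verbatim)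

HONEST FRAMING (page 1 of everything in this cell).  Discharging `FlowStep.BetaPertH` would make Bałaban's ultraviolet
stability UNCONDITIONAL — a constructive-QFT result; it is NOT the continuum limit and NOT the Clay problem.  This module
discharges nothing of `BetaPertH`; it is ELEMENTARY finite-dimensional linear algebra ([folklore]: the Agmon ∕ Combes–Thomas
weighted-ℓ² bookkeeping, real Cauchy–Schwarz), kernel-checked, written by the OWNER of binder row D4 (unit
`b2b-balaban-beta-an4`, gen 43; claim «MULTISCALE-CT-L2LOCAL», journal l.19274) for NODE O.2 item (v) «k-UNIFORM constants».
HONEST DEPENDENCY: continuum YM on T⁴ ⇐ BetaPertH ∧ nine spine estimates (0/9 proved); BetaPertH ⇐ (D1) ∧ (D4) ∧ CAP+tail;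
G-an2-4 gates asym, D1 and NE2/3/4.

WHY THIS FILE.  File 5 (`MultiscaleCombesThomasL2`) states the ℓ²-localized operator bound — the SHAPE of the L²-norm member
(3.46)₁ of [Balaban1985BackgroundPropagators] Thm 3.1 p. 398 («‖hG′(U)λ‖ ≦ B₀(L^jη)²|h|e^{−δ₀d(y,y′)}‖λ‖ for supp h ⊂ Δ(y),
y ∈ Λ_j, supp λ ⊂ Δ(y′)», locator only) — for complex MATRICES with the `conjForm` hypothesis of `AccretiveCombesThomas`.
The MODEL instance of co-owner beta-d4-p2 (`MultiscaleDecay`, p230877) is written for REAL ENDOMORPHISMS `Module.End ℝ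
(UT N × Cp → ℝ)` with the conjugated-PAIRING hypothesis `∀ v, Σ_p μ_p v_p² ≤ Σ_p e^{κρ_p}v_p·(A(e^{−κρ}v))_p` (its
`hc_levelOp`, profile `μ_p = μ₀·n(p)⁻²`, weight `ρ = d_n(·, y)`; the same shape as file 2's `norm_cmat_inv_apply_le_local`).
This file proves file 5's §1 directly in that currency (no complexification): `real_weighted_solution_bound`,
`real_weighted_set_solution_bound`, **`real_set_norm_inverse_le`** for `Ring.inverse A`.  Fed by `hc_levelOp` with `S, S′`
two cells of the covering family, `ω` = the oscillation of `d_n(·, y)` over the source cell (`≤ 2d`,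
`MultiscaleDistance` §3) and `R ≥ d_n − 2d` on the target cell: `‖1_S(levelOp)⁻¹1_{S′}‖_{ℓ²→ℓ²} ≤ e^{4dκ}·n(S)n(S′)/μ₀·
e^{−κd_n}` — level-count- and volume-free, NO ℓ² → ℓ^∞ step (the sup-norm members (3.42)–(3.45) stay behind O.2 item
(ii)).  [folklore]; nothing printed asserted; (3.46) is a LOCATOR of the shape; nothing of other lineages restated (file 5's
`sqrt_le_of_weighted` and T4's `le_of_le_sqrt_mul_sqrt` BY NAME).  Row D4: abstract engine, ℓ²-operator currency; class of
(T3) ∕ NODE O.2 UNCHANGED (critical-path width 0); D4 DISCHARGE NO DATE; NOT BetaPertH, NOT continuum, NOT Clay, NOT summit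
progress.
-/

open scoped BigOperators
open Finset

namespace Summit.QuantumFields.BalabanUV.Beta.MultiscaleCombesThomasL2Real

open Summit.QuantumFields.BalabanUV.Beta.MultiscaleCombesThomasL2 (sqrt_le_of_weighted)
open Summit.QuantumFields.BalabanUV.T4Continuum.RegionGaugeSliceOrth (le_of_le_sqrt_mul_sqrt)

noncomputable section

/-! ## §1 The real weighted solution bound and its localized forms -/

variable {Y : Type*} [Fintype Y]

/-- **The real weighted solution bound** (no complexification): for a real endomorphism `A` of `Y → ℝ` with the
conjugated-PAIRING hypothesis `∀ v, Σ_p μ_p v_p² ≤ Σ_p e^{κρ_p}v_p·(A(e^{−κρ}v))_p` (the shape of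
`MultiscaleDecay.hc_levelOp` ∕ `MultiscaleCombesThomasBudget.norm_cmat_inv_apply_le_local`) and `Aw = u`:
`Σ_p μ_p e^{2κρ_p} w_p² ≤ Σ_p μ_p⁻¹ e^{2κρ_p} u_p²` (real Cauchy–Schwarz). [folklore] -/
theorem real_weighted_solution_bound {A : Module.End ℝ (Y → ℝ)} {κ : ℝ} {ρ : Y → ℝ} {μ : Y → ℝ} (hμ : ∀ p, 0 < μ p)
    (hc : ∀ v : Y → ℝ, ∑ p, μ p * v p ^ 2 ≤
      ∑ p, Real.exp (κ * ρ p) * v p * A (fun q => Real.exp (-(κ * ρ q)) * v q) p)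
    {w u : Y → ℝ} (hw : A w = u) :
    ∑ p, μ p * (Real.exp (κ * ρ p) * w p) ^ 2 ≤ ∑ p, (μ p)⁻¹ * (Real.exp (κ * ρ p) * u p) ^ 2 := by
  -- apply `hc` to `v = e^{κρ}w`; then `e^{−κρ}v = w` and `A(e^{−κρ}v) = u`
  set v : Y → ℝ := fun p => Real.exp (κ * ρ p) * w p with hvdef
  have hback : (fun q => Real.exp (-(κ * ρ q)) * v q) = w := by
    funext q
    rw [hvdef]
    simp only
    rw [← mul_assoc, ← Real.exp_add, show -(κ * ρ q) + κ * ρ q = 0 by ring, Real.exp_zero, one_mul]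
  have h := hc v
  rw [hback, hw] at h
  -- Cauchy–Schwarz: Σ e^{κρ}v·u = Σ (√μ v)(e^{κρ}u/√μ) ≤ √(Σ μ v²) √(Σ μ⁻¹ (e^{κρ}u)²)
  set Pv := ∑ p, μ p * v p ^ 2 with hPv
  set Qu := ∑ p, (μ p)⁻¹ * (Real.exp (κ * ρ p) * u p) ^ 2 with hQu
  have hPv0 : 0 ≤ Pv := Finset.sum_nonneg fun p _ => mul_nonneg (hμ p).le (sq_nonneg _)
  have hQu0 : 0 ≤ Qu := Finset.sum_nonneg fun p _ => mul_nonneg (inv_nonneg.mpr (hμ p).le) (sq_nonneg _)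
  have hcs : ∑ p, Real.exp (κ * ρ p) * v p * u p ≤ Real.sqrt Pv * Real.sqrt Qu := by
    have hrw : ∑ p, Real.exp (κ * ρ p) * v p * u p =
        ∑ p, (Real.sqrt (μ p) * v p) * ((Real.sqrt (μ p))⁻¹ * (Real.exp (κ * ρ p) * u p)) := by
      refine Finset.sum_congr rfl fun p _ => ?_
      have hs : Real.sqrt (μ p) ≠ 0 := (Real.sqrt_pos.mpr (hμ p)).ne'
      field_simp
    rw [hrw]
    have hcs' := Real.sum_mul_le_sqrt_mul_sqrt univ (fun p => Real.sqrt (μ p) * v p)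
      (fun p => (Real.sqrt (μ p))⁻¹ * (Real.exp (κ * ρ p) * u p))
    have h1 : ∑ p, (Real.sqrt (μ p) * v p) ^ 2 = Pv := by
      rw [hPv]; exact Finset.sum_congr rfl fun p _ => by rw [mul_pow, Real.sq_sqrt (hμ p).le]
    have h2 : ∑ p, ((Real.sqrt (μ p))⁻¹ * (Real.exp (κ * ρ p) * u p)) ^ 2 = Qu := by
      rw [hQu]; exact Finset.sum_congr rfl fun p _ => by rw [mul_pow, inv_pow, Real.sq_sqrt (hμ p).le]
    rw [h1, h2] at hcs'
    exact hcs'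
  have hmain : Pv ≤ Real.sqrt Pv * Real.sqrt Qu := h.trans hcs
  have hfin : Pv ≤ Qu := le_of_le_sqrt_mul_sqrt hPv0 hQu0 hmain
  -- read back `v = e^{κρ}w`
  have hPv' : Pv = ∑ p, μ p * (Real.exp (κ * ρ p) * w p) ^ 2 := by rw [hPv]
  rw [hPv'] at hfin
  exact hfin

/-- **The real localized weighted solution bound (sets).**  As `weighted_set_solution_bound`, in the real-operator currency:
`ν·e^{2κR}·Σ_{p∈S} w_p² ≤ ν′⁻¹·e^{2κω}·Σ_{p∈S′} u_p²` for `Aw = u`, `u` supported in `S′` (`ρ ≤ ω`, `μ ≥ ν′` there), `S` with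
`ρ ≥ R`, `μ ≥ ν`. [folklore] -/
theorem real_weighted_set_solution_bound {A : Module.End ℝ (Y → ℝ)} {κ : ℝ} {ρ : Y → ℝ} {μ : Y → ℝ}
    (hμ : ∀ p, 0 < μ p) (hκ : 0 ≤ κ)
    (hc : ∀ v : Y → ℝ, ∑ p, μ p * v p ^ 2 ≤
      ∑ p, Real.exp (κ * ρ p) * v p * A (fun q => Real.exp (-(κ * ρ q)) * v q) p)
    {w u : Y → ℝ} (hw : A w = u) (S S' : Finset Y) (hu : ∀ p, p ∉ S' → u p = 0) {R ω ν ν' : ℝ}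
    (hν' : 0 < ν') (hR : ∀ p ∈ S, R ≤ ρ p) (hω : ∀ p ∈ S', ρ p ≤ ω) (hνS : ∀ p ∈ S, ν ≤ μ p)
    (hνS' : ∀ p ∈ S', ν' ≤ μ p) :
    ν * Real.exp (2 * (κ * R)) * ∑ p ∈ S, w p ^ 2 ≤ (ν')⁻¹ * Real.exp (2 * (κ * ω)) * ∑ p ∈ S', u p ^ 2 := by
  have h := real_weighted_solution_bound hμ hc hw
  have hsq : ∀ (t a : ℝ), (Real.exp t * a) ^ 2 = Real.exp (2 * t) * a ^ 2 := fun t a => by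
    rw [mul_pow, show (2 : ℝ) * t = t + t by ring, Real.exp_add, sq (Real.exp t)]
  have hL : ν * Real.exp (2 * (κ * R)) * ∑ p ∈ S, w p ^ 2 ≤ ∑ p, μ p * (Real.exp (κ * ρ p) * w p) ^ 2 := by
    calc ν * Real.exp (2 * (κ * R)) * ∑ p ∈ S, w p ^ 2 = ∑ p ∈ S, ν * Real.exp (2 * (κ * R)) * w p ^ 2 := by
          rw [Finset.mul_sum]
      _ ≤ ∑ p ∈ S, μ p * (Real.exp (κ * ρ p) * w p) ^ 2 := by
          refine Finset.sum_le_sum fun p hp => ?_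
          have hfac : ν * Real.exp (2 * (κ * R)) ≤ μ p * Real.exp (2 * (κ * ρ p)) :=
            mul_le_mul (hνS p hp) (Real.exp_le_exp.mpr (by nlinarith [hR p hp])) (Real.exp_pos _).le (hμ p).le
          calc ν * Real.exp (2 * (κ * R)) * w p ^ 2 ≤ μ p * Real.exp (2 * (κ * ρ p)) * w p ^ 2 :=
                mul_le_mul_of_nonneg_right hfac (sq_nonneg _)
            _ = μ p * (Real.exp (κ * ρ p) * w p) ^ 2 := by rw [hsq, mul_assoc]
      _ ≤ ∑ p, μ p * (Real.exp (κ * ρ p) * w p) ^ 2 :=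
          Finset.sum_le_sum_of_subset_of_nonneg (Finset.subset_univ S) fun p _ _ =>
            mul_nonneg (hμ p).le (sq_nonneg _)
  have hU : ∑ p, (μ p)⁻¹ * (Real.exp (κ * ρ p) * u p) ^ 2 ≤ (ν')⁻¹ * Real.exp (2 * (κ * ω)) * ∑ p ∈ S', u p ^ 2 := by
    have hsplit : ∑ p, (μ p)⁻¹ * (Real.exp (κ * ρ p) * u p) ^ 2 = ∑ p ∈ S', (μ p)⁻¹ * (Real.exp (κ * ρ p) * u p) ^ 2 := by
      symm
      refine Finset.sum_subset (Finset.subset_univ S') fun p _ hp => ?_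
      rw [hu p hp]; simp
    rw [hsplit, Finset.mul_sum]
    refine Finset.sum_le_sum fun p hp => ?_
    have hfac : (μ p)⁻¹ * Real.exp (2 * (κ * ρ p)) ≤ (ν')⁻¹ * Real.exp (2 * (κ * ω)) :=
      mul_le_mul (inv_anti₀ hν' (hνS' p hp)) (Real.exp_le_exp.mpr (by nlinarith [hω p hp]))
        (Real.exp_pos _).le (inv_nonneg.mpr hν'.le)
    calc (μ p)⁻¹ * (Real.exp (κ * ρ p) * u p) ^ 2 = (μ p)⁻¹ * Real.exp (2 * (κ * ρ p)) * u p ^ 2 := by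
          rw [hsq, mul_assoc]
      _ ≤ (ν')⁻¹ * Real.exp (2 * (κ * ω)) * u p ^ 2 := mul_le_mul_of_nonneg_right hfac (sq_nonneg _)
  exact hL.trans (h.trans hU)

/-- **The real ℓ²-localized bound for the inverse operator — the (3.46)₁ SHAPE in the MODEL's currency.**  `A` a unit with
the conjugated-pairing hypothesis at `(κ, ρ)` and sitewise profile `μ > 0`; `u` supported in `S′` (`ρ ≤ ω`, `μ ≥ ν′` there);
`S` with `ρ ≥ R`, `μ ≥ ν`.  Then `√(Σ_{p∈S}(A⁻¹u)_p²) ≤ e^{−κ(R−ω)}/√(νν′)·√(Σ_{p∈S′}u_p²)` for `A⁻¹ = Ring.inverse A`.  Fed by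
`MultiscaleDecay.hc_levelOp` (profile `μ₀·n(p)⁻²`, weight `κ·d_n(·, y)`), with `S, S′` two cells: the localized ℓ² → ℓ² bound
`e^{O(κ)}·n(S)n(S′)/μ₀·e^{−κd_n}` — level-count- and volume-free. [cite: Balaban1985BackgroundPropagators, Thm 3.1 (3.46) p.398] [folklore] -/
theorem real_set_norm_inverse_le {A : Module.End ℝ (Y → ℝ)} (hA : IsUnit A) {κ : ℝ} {ρ : Y → ℝ} {μ : Y → ℝ}
    (hμ : ∀ p, 0 < μ p) (hκ : 0 ≤ κ)
    (hc : ∀ v : Y → ℝ, ∑ p, μ p * v p ^ 2 ≤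
      ∑ p, Real.exp (κ * ρ p) * v p * A (fun q => Real.exp (-(κ * ρ q)) * v q) p)
    (S S' : Finset Y) {u : Y → ℝ} (hu : ∀ p, p ∉ S' → u p = 0) {R ω ν ν' : ℝ} (hν : 0 < ν) (hν' : 0 < ν')
    (hR : ∀ p ∈ S, R ≤ ρ p) (hω : ∀ p ∈ S', ρ p ≤ ω) (hνS : ∀ p ∈ S, ν ≤ μ p) (hνS' : ∀ p ∈ S', ν' ≤ μ p) :
    Real.sqrt (∑ p ∈ S, (Ring.inverse A) u p ^ 2) ≤
      Real.exp (-(κ * (R - ω))) / Real.sqrt (ν * ν') * Real.sqrt (∑ p ∈ S', u p ^ 2) := by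
  have hw : A ((Ring.inverse A) u) = u := by
    rw [← Module.End.mul_apply, Ring.mul_inverse_cancel _ hA, Module.End.one_apply]
  exact sqrt_le_of_weighted hν hν'
    (real_weighted_set_solution_bound hμ hκ hc hw S S' hu hν' hR hω hνS hνS')


/-! ## §2 Witness: the real hypothesis list is jointly satisfiable and the bound fires -/

/-- One site, `A = id`, profile `μ ≡ 1`, weight `ρ ≡ 0`, `S = S′ = univ`, `R = ω = 0`, `ν = ν′ = 1`, `u ≡ 1`: every binder of
`real_set_norm_inverse_le` discharges and the bound fires (`√(Σ(A⁻¹u)²) ≤ e^{0}/√(1·1)·√(Σu²)`). [folklore] -/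
example (κ : ℝ) (hκ : 0 ≤ κ) :
    Real.sqrt (∑ p ∈ (univ : Finset Unit), (Ring.inverse (1 : Module.End ℝ (Unit → ℝ))) (fun _ => 1) p ^ 2) ≤
      Real.exp (-(κ * (0 - 0))) / Real.sqrt (1 * 1) * Real.sqrt (∑ p ∈ (univ : Finset Unit), (fun _ : Unit => (1 : ℝ)) p ^ 2) := by
  refine real_set_norm_inverse_le isUnit_one (μ := fun _ => 1) (ρ := fun _ => 0) (fun _ => by norm_num) hκ (fun v => ?_)
    univ univ (fun _ h => absurd (mem_univ _) h) (by norm_num) (by norm_num) (fun _ _ => le_rfl) (fun _ _ => le_rfl)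
    (fun _ _ => le_rfl) (fun _ _ => le_rfl)
  -- the pairing hypothesis: `Σ 1·v² ≤ Σ e^0 v · (id (e^0 v))`
  simp only [Fintype.univ_ofSubsingleton, Finset.sum_singleton, mul_zero, neg_zero, Real.exp_zero, one_mul,
    Module.End.one_apply]
  nlinarith [sq_nonneg (v ())]

end

end Summit.QuantumFields.BalabanUV.Beta.MultiscaleCombesThomasL2Real
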